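import Mathlib
import HarnessLib
import HarnessLib.Audit
import Summits.AtomisticToContinuum.Statement
import Literature.Analysis.FunctionSpaces.TorusMollifier

/-!
Route: HeatBathCells

CLOSED (retired) 2026-08-15T13:43:09Z by operator:999:1257524 — reason: not-a-thesis: assembly does not conclude the sub-problem Statement — note: D-0027 §2.1 audit (human 2026-08-15: routes that do not decide the summit are removed): the assembly concludes `Literature.MathematicalPhysics.KineticTheory.HydrodynamicLimit`, not the sub-problem statement; a NEW conforming route may be opened from the same idea (generated `closes : … → _root_.Hydr. The file is kept as the record of this route; refuted decls are indexed as negative knowledge (`ledger negatives`).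

# Route HeatBathCells — the gas is its own heat bath — mesoscopic cells forget conservative interior
surgery in law within a vanishing window, giving Yau's one-block flux closure without noise

X ("it suffices to show"; item MesoFluxClosure, rank 0): MESOSCOPIC FLUX CLOSURE IN MEAN along the
true deterministic evolution.
For continuous local-Gibbs profiles there is σ₀ > 0 such that for every reduced density 0 < σ < σ₀,
every classical hard-sphere
Euler solution on [0,T), every family of hard-sphere flows Φ_N and every t < T, at SOME mesoscopic
block scale h_N = (N+1)^(-α),
0 < α < 1/3 (blocks microscopically large, macroscopically small), the exact empirical conservation
laws close on the Euler
fluxes: for all 0 ≤ t₁ ≤ t₂ ≤ t and smooth ζ, the increment of the empirical energy field (resp.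
each component of the empirical
momentum field) tested against ζ, minus ∫ from t₁ to t₂ of ∫ over 𝕋³ of the hard-sphere Euler flux
(E+p)m/ρ (resp. m⊗m/ρ + p𝟙,
p = ρθZ(ρσ³) = hsPressure) EVALUATED AT THE h_N-MOLLIFIED EMPIRICAL FIELDS and tested against ∇ζ, is
integrable and has
expectation ≤ δ under the initial local Gibbs law for N ≥ N₀(δ). This is exactly the one-block input
Yau's relative entropy
method consumes (the microscopic current enters the Gronwall identity only inside an expectation
against the smooth weight ∇λ),
typed WITHOUT microscopic currents: the weak-in-time form lets exact conservation account for the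
collisional transfer.
The route realises card gas-is-its-own-heat-bath (spine; card borrowed-noise-inflow-cells was
retired into it) as the MECHANISM for X:
CellRefresh (rank 2: law-level forgetting of conservative cellwise surgeries — the torus shadow of
"Doeblin inside", honouring triage
flag (ii): laws, not paths) and RefreshToClosure (rank 3: the Dobrushin–Shlosman identification
step), and docks X into Yau's method
by ClosureToEntropy (rank 4) and the shared items RelEntropyVanishing (0766) / EntropyToHydro
(0769).
Lean: `∀ (a₀ θ₀ : Literature.MathematicalPhysics.KineticTheory.T3 → ℝ) (u₀ :
Literature.MathematicalPhysics.KineticTheory.T3 → Literature.MathematicalPhysics.KineticTheory.V3),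
Continuous a₀ → Continuous θ₀ → Continuous u₀ → (∀ x, 0 < a₀ x) → (∀ x, 0 < θ₀ x) → ∃ σ₀ : ℝ, 0 < σ₀
∧ ∀ σ : ℝ, 0 < σ → σ < σ₀ → ∀ (T : ℝ) (ρ θ : ℝ → Literature.MathematicalPhysics.KineticTheory.T3 →
ℝ) (u : ℝ → Literature.MathematicalPhysics.KineticTheory.T3 →
Literature.MathematicalPhysics.KineticTheory.V3),
Literature.MathematicalPhysics.KineticTheory.IsHardSphereEulerSolution σ T ρ u θ → ∀ Φ : (N : ℕ) →
Literature.Analysis.FluidPDE.HardSphereFlow (Literature.Analysis.FluidPDE.Torus.geometry (Fin 3))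
(Literature.MathematicalPhysics.KineticTheory.hsDiameter σ N) (N + 1),
Literature.MathematicalPhysics.KineticTheory.TendstoHydroFieldsAt (fun N =>
Literature.MathematicalPhysics.KineticTheory.localGibbsLaw σ a₀ u₀ θ₀ N (Φ N)) Φ ρ u θ 0 → ∃ α : ℝ,
0 < α ∧ α < 1 / 3 ∧ ∀ t ∈ Set.Ico 0 T, ∀ t₁ t₂ : ℝ, 0 ≤ t₁ → t₁ ≤ t₂ → t₂ ≤ t → ∀ ζ :
Literature.MathematicalPhysics.KineticTheory.T3 → ℝ,
Literature.Analysis.FunctionSpaces.Torus.IsSmooth ζ → ∀ δ : ℝ, 0 < δ → ∃ N₀ : ℕ, ∀ N : ℕ, N₀ ≤ N →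
(let h : ℝ := ((N + 1 : ℕ) : ℝ) ^ (-α); let P :=
Literature.MathematicalPhysics.KineticTheory.localGibbsLaw σ a₀ u₀ θ₀ N (Φ N); let ρb := fun (w :
Literature.Analysis.FluidPDE.Config (N + 1) (Fin 3) Literature.MathematicalPhysics.KineticTheory.T3)
(x : Literature.MathematicalPhysics.KineticTheory.T3) =>
Literature.MathematicalPhysics.KineticTheory.empiricalDensityField w (fun y =>
Literature.Analysis.FunctionSpaces.Torus.kernel h (y - x)); let mb := fun (w :
Literature.Analysis.FluidPDE.Config (N + 1) (Fin 3) Literature.MathematicalPhysics.KineticTheory.T3)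
(x : Literature.MathematicalPhysics.KineticTheory.T3) =>
Literature.MathematicalPhysics.KineticTheory.empiricalMomentumField w (fun y =>
Literature.Analysis.FunctionSpaces.Torus.kernel h (y - x)); let eb := fun (w :
Literature.Analysis.FluidPDE.Config (N + 1) (Fin 3) Literature.MathematicalPhysics.KineticTheory.T3)
(x : Literature.MathematicalPhysics.KineticTheory.T3) =>
Literature.MathematicalPhysics.KineticTheory.empiricalEnergyField w (fun y =>
Literature.Analysis.FunctionSpaces.Torus.kernel h (y - x)); let pb := fun (w :
Literature.Analysis.FluidPDE.Config (N + 1) (Fin 3) Literature.MathematicalPhysics.KineticTheory.T3)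
(x : Literature.MathematicalPhysics.KineticTheory.T3) =>
Literature.MathematicalPhysics.KineticTheory.hsPressure σ (ρb w x) (2 / 3 * (eb w x / ρb w x - ‖mb w
x‖ ^ 2 / (2 * ρb w x ^ 2))); let mg := fun (w : Literature.Analysis.FluidPDE.Config (N + 1) (Fin 3)
Literature.MathematicalPhysics.KineticTheory.T3) (x :
Literature.MathematicalPhysics.KineticTheory.T3) => ∑ j : Fin 3, mb w x j *
Literature.Analysis.FunctionSpaces.Torus.partialDeriv j ζ x; let Den := fun (z :
Literature.Analysis.FluidPDE.Config (N + 1) (Fin 3) Literature.MathematicalPhysics.KineticTheory.T3)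
=> Literature.MathematicalPhysics.KineticTheory.empiricalEnergyField ((Φ N).flow t₂ z) ζ -
Literature.MathematicalPhysics.KineticTheory.empiricalEnergyField ((Φ N).flow t₁ z) ζ - ∫ s in
Set.Icc t₁ t₂, ∫ x : Literature.MathematicalPhysics.KineticTheory.T3, (eb ((Φ N).flow s z) x + pb
((Φ N).flow s z) x) / ρb ((Φ N).flow s z) x * mg ((Φ N).flow s z) x; let Dmo := fun (k : Fin 3) (z :
Literature.Analysis.FluidPDE.Config (N + 1) (Fin 3) Literature.MathematicalPhysics.KineticTheory.T3)
=> Literature.MathematicalPhysics.KineticTheory.empiricalMomentumField ((Φ N).flow t₂ z) ζ k -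
Literature.MathematicalPhysics.KineticTheory.empiricalMomentumField ((Φ N).flow t₁ z) ζ k - ∫ s in
Set.Icc t₁ t₂, ∫ x : Literature.MathematicalPhysics.KineticTheory.T3, (mg ((Φ N).flow s z) x * mb
((Φ N).flow s z) x k / ρb ((Φ N).flow s z) x + pb ((Φ N).flow s z) x *
Literature.Analysis.FunctionSpaces.Torus.partialDeriv k ζ x); (MeasureTheory.Integrable Den P ∧ |∫
z, Den z ∂P| ≤ δ) ∧ ∀ k : Fin 3, MeasureTheory.Integrable (Dmo k) P ∧ |∫ z, Dmo k z ∂P| ≤ δ)`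

## Assembly
Pure logic (term `fun h2 h3 h5 h7 h8 h4 h9 => h9 (h4 (h3 h2 h5 h8) h5 h7 h8)`, checked sorry-free in
Sketch.lean): CellRefresh and
the a-priori bound CubicMomentUI give MesoFluxClosure through RefreshToClosure (with the equation of
state HsEosLowDensity);
ClosureToEntropy turns closure + CubicMomentUI + the equilibrium inputs LocalGibbsConcentration,
HsEosLowDensity into
RelEntropyVanishing; EntropyToHydro is the entropy inequality.

Rationale: WHY THIS LINE. OllaVaradhanYau1993 need the weak noise in exactly one step — the classification of
regular translation-invariant stationary states,
whose flux-level corollary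
`Literature.Barriers.AtomisticToContinuum.BoltzmannHypothesisBarrierNarrow` isolates — and this line
locates the missing randomness INSIDE the deterministic gas: seen from a mesoscopic cell the rest of
the gas is a stochastic reservoir
that injects particles carrying the initial law's randomness and flushes every resident, the setting
of the uniqueness/convergence
theorems for mechanical systems with stochastic boundaries (GoldsteinKipnisIaniro1985;
Goldstein–Lebowitz–Presutti 1981) and for
random billiards driven by thermostats (KhaninYarmola2013, Yarmola2014), while the self-consistency
across cells is a dynamical DLR
problem of the kind settled by constructive uniqueness criteria for PCA / space-time Gibbs fields
(DobrushinShlosman1985,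
MaesShlosman1991, LebowitzMaesSpeer1990). Imported areas, with the dictionary drive ↦ incoming
record through cell faces, update
noise ↦ initial randomness delivered by streaming, Dobrushin contraction ↦ surface/volume forgetting
at cell side ≫ mean free path:
nonequilibrium open-system ergodic theory and DLR/PCA uniqueness theory; the docking is Yau1991 /
KipnisLandim1999 Ch. 6.
New relative to the five open routes and the (empty) negatives index: no bulk noise (VanishingNoise
0811), no mixing rates of CLOSED
boxes (ChaoticMixing 0830), no infinite-volume classification (RelEntropyErgodic 0779): the rank-2
crux is a finite-N LAW-LEVEL
FORGETTING statement placed in the only window where cells are actually flushed at Euler scaling —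
flushing is diffusive with
D ≍ λv̄ ≍ (N+1)^(-1/3), so a cell of side h empties in h²(N+1)^(1/3) log N and the window is
(N+1)^(-1/3) ≪ h_N ≪ (N+1)^(-1/6); the route
fixes h_N ≍ (N+1)^(-1/4) (cells of N^(1/4) particles spanning N^(1/12) mean free paths) and τ_N =
(N+1)^(-1/12).

RANKED CRUXES. #0 MesoFluxClosure (target) — X of § Thesis — mesoscopic flux closure in mean at some
block scale (N+1)^(-α), α ∈ (0,1/3), for the energy and the three momentum conservation laws, along
the true evolution from local Gibbs data, σ < σ₀, t < T. (why it might fail: a persistent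
sub-mesoscopic velocity–position structure of the deterministic gas (the interacting analogue of the
free-gas rest-frame heat current, BoltzmannHypothesisBarrierNarrow kernel (5)) would shift the mean
flux away from F(U_h) at leading order.) [OllaVaradhanYau1993, Yau1991, KipnisLandim1999, Spohn1991]
#2 CellRefresh (crux) — LAW-LEVEL FORGETTING OF CONSERVATIVE CELLWISE SURGERY (card
gas-is-its-own-heat-bath item (ii) "Doeblin inside", restated at law level on the torus; card
borrowed-noise-inflow-cells crux 1). Along the true evolution from local Gibbs data (σ < σ₀, horizon
t < T), partition 𝕋³ into the cubic grid of mesh 1/M, M = ⌊(N+1)^(1/4)⌋. For every measurable Ψ on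
N-particle phase space that preserves the Liouville measure and the hard-core constraint, keeps
every particle inside its grid cell and conserves the momentum and the kinetic energy of every cell,
applying Ψ to the configuration at any time s ≤ t changes the expectation of every normalised
bounded continuous one-particle cell observable (ball of radius 1/M, arbitrary centre x) at time s +
τ_N, τ_N = (N+1)^(-1/12), by at most δ·τ_N, uniformly in s ≤ t, x and Ψ, for N ≥ N₀(δ, g, t). (The
admissible Ψ include Haar rotations of cell velocities in the centre-of-mass frame and velocity
reversal in that frame; the bound o(τ_N) is what lets window increments be read as fluxes.)
[difficulty: open-problem] (why it might fail: flushing is diffusive and influence percolates inside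
a cell, so forgetting must come from the exterior's conditional randomness; a Liouville-preserving
demon surgery reading the exterior microstate, slow/fast velocity tails (Yarmola2014) or memory
decaying slower than (N+1)^(-1/12) break it.) [GoldsteinKipnisIaniro1985, KhaninYarmola2013,
Yarmola2014, ChernovDolgopyat2009, OllaVaradhanYau1993]
#3 RefreshToClosure (crux) — FORGETTING ⇒ CLOSURE (card item (iii), the Dobrushin–Shlosman
identification, at finite N): CellRefresh → CubicMomentUI → HsEosLowDensity → MesoFluxClosure.
Intended proof: cut [t₁,t₂] into windows of length τ_N; by exact conservation the window increment
of ⟨η, ζ⟩ IS the time-integrated flux (collisional transfer included); by CellRefresh with the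
randomised admissible surgery "resample every cell microcanonically at the window start" (average of
admissible Ψ's) the mean increment equals, up to o(τ_N), the one computed from the
cellwise-Gibbsianised law; that law produces only o(N) relative entropy over the window (face
crossings × quadratic parameter jumps ≍ h_N⁻⁴·τ_N = N^(11/12) = o(N)), so its mean flux is the Gibbs
expectation = Euler flux at the cell parameters by the virial theorem and low-density equivalence of
ensembles (Knudsen layers at cell faces have volume fraction λ/h_N → 0); CubicMomentUI truncates the
unbounded flux observables. [deps: CellRefresh, CubicMomentUI, HsEosLowDensity] [difficulty: XL]
(why it might fail: forgetting alone identifies nothing (the free gas forgets perfectly yet violates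
closure, BoltzmannHypothesisBarrierNarrow (5)); needs measure-preserving position scramblers
respecting the hard core at cell faces, and the window entropy bound N^(11/12)=o(N) leaves no room
for lost logarithms.) [DobrushinShlosman1985, MaesShlosman1991, LebowitzMaesSpeer1990,
OllaVaradhanYau1993, Ruelle1969, LebowitzPenrose1964]
#4 ClosureToEntropy (crux) — YAU'S GRONWALL GIVEN THE ONE-BLOCK INPUT: MesoFluxClosure →
CubicMomentUI → LocalGibbsConcentration → HsEosLowDensity → RelEntropyVanishing. With ψ_t the local
Gibbs law built on the Euler solution (activity a(ρ_t, σ) by the inverse equation of state),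
H(f_t|ψ_t) − H(f_0|ψ_0) = −∫₀ᵗ E_(f_s)[(∂_s + L) log ψ_s] ds is a sum of field increments and ∫⟨η_s,
∂_sλ⟩; MesoFluxClosure replaces the increments by ∫∫ F(U_h)·∇λ in mean; the Euler equations kill the
linear part, the quadratic remainder is ≤ C·H + o(N) by the entropy inequality and the
large-deviation upper bound for ψ_t, the far-field part by CubicMomentUI; H(f_0|ψ_0) = 0 because the
t = 0 field convergence pins (a₀,u₀,θ₀) to the Euler data; Gronwall. [deps: MesoFluxClosure,
CubicMomentUI, LocalGibbsConcentration, HsEosLowDensity] [difficulty: L] (why it might fail: needs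
equilibrium inputs beyond the typed ones (mesoscopic large-deviation/pressure-functional bound for
ψ_t at block scale, inverse activity–density map), and mean-form closure must suffice — true for
Yau1991's identity, false for any step needing pathwise replacement.) [Yau1991, OllaVaradhanYau1993,
KipnisLandim1999, Ruelle1969, LebowitzPenrose1964]
#5 CubicMomentUI (crux) — UNIFORM INTEGRABILITY OF THE CUBIC VELOCITY MOMENT ALONG THE EVOLUTION
(the honest form of LargeVelocityControl 0781 — exponential cubic moments are infinite already for
Maxwellians): for σ < σ₀, local Gibbs data and t < T, sup over s ≤ t and N ≥ N₀ of E[(N+1)⁻¹ Σ_i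
|v_i(s)|³ 1(|v_i(s)| > K)] ≤ δ for K = K(δ, t). Needed to truncate the energy flux (E+p)m/ρ ≲ block
average of |v|³ in cruxes 3 and 4. [difficulty: L] (why it might fail: only total kinetic energy is
conserved; a vanishing fraction of particles could take a non-vanishing energy share over
macroscopic times (cascade to fast particles) and no a-priori estimate excludes this at fixed
density (HighMomentumCutoffBarrier: OVY modified the kinetic energy to avoid it).)
[OllaVaradhanYau1993, Spohn1991, KipnisLandim1999]
#9 RelEntropyVanishing (support) — Yau's relative-entropy form of the hydrodynamic limit (shared
item stmt-AtomisticToContinuum-0766 of route RelEntropyErgodic, same signature): specific relative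
entropy of the time-t law w.r.t. the local Gibbs law on the Euler solution vanishes, with
exponential concentration of the reference fields. [difficulty: open-problem] [Yau1991,
OllaVaradhanYau1993]
#9 LocalGibbsConcentration (support) — exponential law of large numbers for canonical local Gibbs
states at small reduced density (shared item stmt-AtomisticToContinuum-0767, same signature;
low-density cluster expansion). [difficulty: M] [Ruelle1969, LebowitzPenrose1964]
#9 HsEosLowDensity (support) — hard-sphere equation of state at low density: analyticity of the
excess free energy and existence of the canonical thermodynamic limit (shared item
stmt-AtomisticToContinuum-0768, same signature). [difficulty: M] [Ruelle1969, LebowitzPenrose1964]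
#9 EntropyToHydro (support) — RelEntropyVanishing → HydrodynamicLimit by the entropy inequality μ(A)
≤ (log 2 + H(μ|λ))/log(1 + 1/λ(A)) (same content as stmt-AtomisticToContinuum-0769). [difficulty:
provable-now] [Yau1991, KipnisLandim1999]

TWO-LAYER PLAN. Foreseen glued splits (filed only after a crux moves; both need the definition
request DrivenHardSphereCell):
CellRefresh ⇐ InjectionRegularity → DrivenCellDoeblin → CellRefresh — InjectionRegularity: at finite
resolution / for the sub-record of
entrants whose backward collision chain reaches far-exterior particles within k steps, the
conditional law of the incoming record of a
cell given its interior is minorised by Poisson–Maxwell injection, the rest controlled in measure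
(triage flag (i); borrowed-noise crux 2);
DrivenCellDoeblin: for the driven cell with minorised injection, the kernel "interior law ↦ interior
law after the flush time" has a
law-level Doeblin constant uniform in the particle number n ≤ η₀(h/ε)³
(GoldsteinKipnisIaniro1985-type theorem made quantitative).
RefreshToClosure ⇐ CellResampling → WindowEntropyBound → RefreshToClosure — CellResampling:
existence of admissible measure-preserving
position-and-velocity scramblers whose average is the cellwise microcanonical resampling;
WindowEntropyBound: a cellwise-Gibbsianised
law produces o(N) relative entropy w.r.t. a smooth local Gibbs fit over a window (N+1)^(-1/12) (face
crossings × quadratic jumps).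
ClosureToEntropy ⇐ MesoscopicPressureFunctional → GronwallIdentity → ClosureToEntropy (the LD upper
bound for ψ_t at block scale).

KILL CRITERIA. ¬CellRefresh with an explicit admissible surgery whose law-level effect after τ_N
stays ≥ c·τ_N (e.g. a sustained non-Maxwellian
cell velocity law regenerated by the dynamics) closes the route `refuted:CellRefresh` and is
evidence for a non-Gibbs regular stationary
structure — hand it to RelEntropyErgodic (¬GibbsErgodicity) and ChaoticMixing. ¬MesoFluxClosure
(mean flux ≠ F(U_h) at leading order for
some smooth pre-shock data) closes this route AND the flux-closure cruxes of DissipativeWeakStrong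
(0823) and RelEntropyErgodic (0780),
and strongly suggests ¬HydrodynamicLimitFor σ — file it. ¬CubicMomentUI (energy cascade) forces a
pivot of cruxes 3–4 to truncated
fluxes with a defect measure (DissipativeWeakStrong's currency). RelEntropyVanishing proved by any
other route moots cruxes 2–4;
GibbsErgodicity (0779) proved makes RefreshToClosure redundant but not CellRefresh.

NOT DECOMPOSED YET. The driven-cell object and its two statements (layer 2 of CellRefresh, see
Two-layer plan) — deliberately not filed: D-0019, and the
definition must land first. The mesoscopic large-deviation/pressure functional for ψ_t and the
inverse activity–density map inside
ClosureToEntropy (layer-2 support). The measure-preserving position scramblers (layer 2 of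
RefreshToClosure). An L¹ (in-probability)
upgrade of MesoFluxClosure (mean form is what Yau's identity consumes; the upgrade would follow from
RelEntropyVanishing a posteriori).
Constants: the exponents 1/4 (cells) and 1/12 (window) are fixed in CellRefresh for composability
(the downstream window-increment
argument needs bias o(τ_N), flush time (N+1)^(-1/6) log N ≪ τ_N, and window entropy N^(4·1/4) τ_N =
o(N)); a variant with other exponents
in ((1/6,1/3), (4α−1, 2α−1/3)) is a restatement, not a new item.

CHEAPEST FALSIFIER. Event-driven MD of the periodic hard-sphere gas at packing fraction 0.01–0.05
with a smooth temperature profile, N = 10⁵–10⁶: apply the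
admissible surgery "reverse all velocities in each grid cell's centre-of-mass frame" (or
"Haar-rotate cell velocities") at time s and
measure the difference of cell one-particle observables at s + τ against the unperturbed run,
averaged over initial samples: CellRefresh
predicts decay to o(τ) once τ exceeds the diffusive flush time h²/(λv̄)·log n_cell; a plateau kills
crux 2 as stated. Theory-side: check
that the free-gas kernel of BoltzmannHypothesisBarrierNarrow (5) does NOT satisfy MesoFluxClosure
while it DOES satisfy CellRefresh —
confirming that RefreshToClosure must use collisions (it is σ > 0 throughout, so this is a sanity
check, not a refutation). Not run here
(kit not in this unit's payload).

NUMBERS. Scales (macroscopic units, N+1 spheres of diameter σ(N+1)^(-1/3) on 𝕋³): mean free path λ ≍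
(N+1)^(-1/3)/(√2πσ²); self-diffusion and
heat/shear diffusivities ≍ λv̄ → 0; cell side h_N = 1/⌊(N+1)^(1/4)⌋ (n_cell ≍ N^(1/4) particles,
h_N/λ ≍ σ²N^(1/12)); diffusive flush time
h_N²/(λv̄)·log n_cell ≍ (N+1)^(-1/6) log N; window τ_N = (N+1)^(-1/12); flush/window ≍ N^(-1/12) log
N; sound-crossing radius during the
window cτ_N ≍ N^(-1/12) ≫ h_N; entropy produced by a cellwise-Gibbsianised law over one window ≍
h_N^(-4) τ_N ≍ N^(11/12) = o(N); sub-cell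
shear/sound modes damp at rate λv̄/h_N² ≍ N^(1/6), i.e. by exp(−N^(1/12)) over the window. Equation
of state Z(η) = 1 + (2π/3)η + O(η²)
(HsEosLowDensity). Items at open: 10 (1 target, 4 cruxes, 4 support, 1 assembly).

DEFINITION REQUESTS. DrivenHardSphereCell (topic
Summits/AtomisticToContinuum/HydrodynamicLimit/Theorems): deterministic hard-sphere dynamics of a
variable
number of spheres in a cube (or ball) of side ℓ with a prescribed INJECTION RECORD (entry times,
entry points on the faces, incoming
velocities) and deletion at exit — a piecewise-deterministic flow on Σ_n Config n built from
`Literature.Analysis.FluidPDE.HardSphereFlow`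
on a box geometry; needed to state InjectionRegularity / DrivenCellDoeblin (layer 2 of CellRefresh).
Filed with `ledger workitem add
--kind definition` right after open. No cite-fact requests: GoldsteinKipnisIaniro1985 /
KhaninYarmola2013 theorems concern fixed n and
thermal walls and are cited as technique, not consumed as hypotheses.

Novelty: Searches (2026-08-15): `lit frontier AtomisticToContinuum --since 2020` (30 rows; nearest:
doi:10.1007/s00222-026-01429-1 = arXiv:2310.13338,
heat equation from a deterministic dynamics by fast chaotic forcing — diffusive, harmonic chain,
external forcing); `lit bridges
AtomisticToContinuum --cross any` (30 rows; no paper joins open-system/stochastic-boundary ergodic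
theory or PCA uniqueness to the
hard-sphere Euler roots); `lit search --source crossref "stationary states mechanical system
stochastic boundary conditions"` (1 relevant:
doi:10.1007/bf01010010); `lit search --source crossref "Dobrushin Shlosman uniqueness criterion
probabilistic cellular automata Maes"`
(doi:10.1007/bf02098042, doi:10.1007/978-1-4899-6653-7_20, doi:10.1007/bf01015566,
doi:10.1007/bf01009964); `lit galaxy search
"mechanical system with stochastic boundary" --star all` (2: panama Grundlehren 320 =
KipnisLandim1999 bibliography; pdf arXiv:math/0612799
Comets–Popov–Schütz–Vachkovskaia, Knudsen billiards with random reflections); galaxy "stochastic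
boundary conditions hard spheres",
"random billiards thermostats mixing", "ergodicity of probabilistic cellular automata" (0 hits
each); local lit index and arXiv/OpenAlex
tiers were down/rate-limited this session (noted in NOTES.md); the five route files, the negatives
index (empty) and the barrier catalogue.
Nearest prior art found: GoldsteinKipnisIaniro1985 (doi:10.1007/bf01010010; stationary state of a
mechanical system with stochastic
boundary: existe  [refs: 10.1007/s00222-026-01429-1, 10.1007/bf01010010, 10.1007/bf02098042, 10.1007/978-1-4899-6653-7_20, 10.1007/bf01015566, 10.1007/bf01009964, 2310.13338, math/0612799, doi:10.1007/s00222-026-01429-1, doi:10.1007/bf01010010, doi:10.1007/bf02098042, doi:10.1007/978-1-4899-6653-7_20, doi:10.1007/bf01015566, doi:10.1007/bf01009964, KipnisLandim1999, GoldsteinKipnisIaniro1985, KhaninYarmola2013, Yarmola201]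

Barriers (technique_class: yau-relative-entropy, open-cell-forgetting, dlr-uniqueness): - technique_class: yau-relative-entropy, open-cell-forgetting, dlr-uniqueness
- Literature.Barriers.AtomisticToContinuum.BoltzmannHypothesisBarrierNarrow: the route supplies a
candidate PROOF of exactly the flux-level input the narrowed barrier isolates (scope caveat (b): a
proof evades it); it does not go through the infinite-volume classification (no stationary-state
object at all: finite N, finite windows), and the free-gas kernel (5) is respected — CellRefresh
holds for free flight while closure fails, so RefreshToClosure must and does use collisions (σ > 0,
virial/EOS identification).
- Literature.Barriers.AtomisticToContinuum.BoltzmannHypothesisBarrier: superseded by the Narrow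
block for this technique class; same evasion.
- Literature.Barriers.AtomisticToContinuum.HighMomentumCutoffBarrierNarrow: MET, with the new
a-priori input it asks for — the cubic energy current never enters an exponential moment: closure is
typed with the Euler flux of BLOCK fields (bounded after truncation at block level, where the
entropy inequality applies) and the far-field remainder is controlled in f-mean by CubicMomentUI
(crux 5); if crux 5 fails the pivot is truncated fluxes with defect measures.
- Literature.Barriers.AtomisticToContinuum.HighMomentumCutoffBarrier: as the Narrow block — met
through crux 5, not evaded by fiat.
- Literature.Barriers.AtomisticToContinuum.NonAttractiveSystemsBarrier: the "coupling" here is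
law-level insensitivity to measure-preserving surgeries, not an order-

History (route lifecycle, newest last):
- 2026-08-15T12:19:01Z · rev 1: restated RefreshToClosure (stmt-AtomisticToContinuum-7375) — restate RefreshToClosure: inline the texts of CubicMomentUI (rank 5) and HsEosLowDensity (support) — the gate writes items in rank order, so a rank-3 implicatio (planner-plancard-AtomisticToContinuum-Hydrody-5b2c460f-0)
- 2026-08-15T13:43:09Z · CLOSED retired — not-a-thesis: assembly does not conclude the sub-problem Statement (operator:999:1257524)

sub-problem: HydrodynamicLimit · status: closed(retired) · opened planner-plancard-AtomisticToContinuum-Hydrody-5b2c460f-0 2026-08-15T12:08:35Z · rev 0 · ledger route-AtomisticToContinuum-HeatBathCells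
GENERATED by the gate from the ledger (D-0016/17). Provers cite these decls: `theorem foo : Summit.AtomisticToContinuum.HydrodynamicLimit.Theses.HeatBathCells.<Decl> := …` in Summits/AtomisticToContinuum/HydrodynamicLimit/Theorems/<Name>.lean.
-/

namespace Summit.AtomisticToContinuum.HydrodynamicLimit.Theses.HeatBathCells

open scoped BigOperators Topology Manifold Classical MeasureTheory ProbabilityTheory Matrix InnerProductSpace ComplexConjugate ContinuousMap
open Filter Set Function TopologicalSpace MeasureTheory

attribute [summit_statement] _root_.HydrodynamicLimit

/-- item stmt-AtomisticToContinuum-7373 · target · rank 0 · closed · moot by None · by planner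
why it might fail: a persistent sub-mesoscopic velocity–position structure of the deterministic gas (the interacting analogue of the free-gas rest-frame heat current, BoltzmannHypothesisBarrierNarrow kernel (5)) would shift the mean flux away from F(U_h) at leading order.
sources: OllaVaradhanYau1993, Yau1991, KipnisLandim1999, Spohn1991
[target] X of § Thesis — mesoscopic flux closure in mean at some block scale (N+1)^(-α), α ∈
(0,1/3), for the energy and the three momentum conservation laws, along the true evolution from
local Gibbs data, σ < σ₀, t < T. -/
@[route_item "route-AtomisticToContinuum-HeatBathCells"]
def MesoFluxClosure : Prop :=
  ∀ (a₀ θ₀ : Literature.MathematicalPhysics.KineticTheory.T3 → ℝ) (u₀ : Literature.MathematicalPhysics.KineticTheory.T3 → Literature.MathematicalPhysics.KineticTheory.V3), Continuous a₀ → Continuous θ₀ → Continuous u₀ → (∀ x, 0 < a₀ x) → (∀ x, 0 < θ₀ x) → ∃ σ₀ : ℝ, 0 < σ₀ ∧ ∀ σ : ℝ, 0 < σ → σ < σ₀ → ∀ (T : ℝ) (ρ θ : ℝ → Literature.MathematicalPhysics.KineticTheory.T3 → ℝ) (u : ℝ → Literature.MathematicalPhysics.KineticTheory.T3 → Literature.MathematicalPhysics.KineticTheory.V3),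 Literature.MathematicalPhysics.KineticTheory.IsHardSphereEulerSolution σ T ρ u θ → ∀ Φ : (N : ℕ) → Literature.Analysis.FluidPDE.HardSphereFlow (Literature.Analysis.FluidPDE.Torus.geometry (Fin 3)) (Literature.MathematicalPhysics.KineticTheory.hsDiameter σ N) (N + 1), Literature.MathematicalPhysics.KineticTheory.TendstoHydroFieldsAt (fun N => Literature.MathematicalPhysics.KineticTheory.localGibbsLaw σ a₀ u₀ θ₀ N (Φ N)) Φ ρ u θ 0 → ∃ α : ℝ, 0 < α ∧ α < 1 / 3 ∧ ∀ t ∈ Set.Ico 0 T, ∀ t₁ t₂ : ℝ, 0 ≤ t₁ → t₁ ≤ t₂ → t₂ ≤ t → ∀ ζ : Literature.MathematicalPhysics.KineticTheory.T3 → ℝ, Literature.Analysis.FunctionSpaces.Torus.IsSmooth ζ → ∀ δ : ℝ, 0 < δ → ∃ N₀ : ℕ, ∀ N : ℕ, N₀ ≤ N → (let h : ℝ := ((N + 1 : ℕ) : ℝ) ^ (-α); let P := Literature.MathematicalPhysics.KineticTheory.localGibbsLaw σ a₀ u₀ θ₀ N (Φ N); let ρb := fun (w : Literature.Analysis.FluidPDE.Config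 (N + 1) (Fin 3) Literature.MathematicalPhysics.KineticTheory.T3) (x : Literature.MathematicalPhysics.KineticTheory.T3) => Literature.MathematicalPhysics.KineticTheory.empiricalDensityField w (fun y => Literature.Analysis.FunctionSpaces.Torus.kernel h (y - x)); let mb := fun (w : Literature.Analysis.FluidPDE.Config (N + 1) (Fin 3) Literature.MathematicalPhysics.KineticTheory.T3) (x : Literature.MathematicalPhysics.KineticTheory.T3) => Literature.MathematicalPhysics.KineticTheory.empiricalMomentumField w (fun y => Literature.Analysis.FunctionSpaces.Torus.kernel h (y - x)); let eb := fun (w : Literature.Analysis.FluidPDE.Config (N + 1) (Fin 3) Literature.MathematicalPhysics.KineticTheory.T3) (x : Literature.MathematicalPhysics.KineticTheory.T3) => Literature.MathematicalPhysics.KineticTheory.empiricalEnergyField w (fun y => Literature.Analysis.FunctionSpaces.Torus.kernel h (y - x)); let pb := fun (w : Literature.Analysis.FluidPDE.Config (N + 1) (Fin 3) Literature.MathematicalPhysics.KineticTheory.T3) (x : Literature.MathematicalPhysics.KineticTheory.T3) => Literature.MathematicalPhysics.KineticTheory.hsPressure σ (ρb w x) (2 / 3 * (eb w x / ρb w x -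 ‖mb w x‖ ^ 2 / (2 * ρb w x ^ 2))); let mg := fun (w : Literature.Analysis.FluidPDE.Config (N + 1) (Fin 3) Literature.MathematicalPhysics.KineticTheory.T3) (x : Literature.MathematicalPhysics.KineticTheory.T3) => ∑ j : Fin 3, mb w x j * Literature.Analysis.FunctionSpaces.Torus.partialDeriv j ζ x; let Den := fun (z : Literature.Analysis.FluidPDE.Config (N + 1) (Fin 3) Literature.MathematicalPhysics.KineticTheory.T3) => Literature.MathematicalPhysics.KineticTheory.empiricalEnergyField ((Φ N).flow t₂ z) ζ - Literature.MathematicalPhysics.KineticTheory.empiricalEnergyField ((Φ N).flow t₁ z) ζ - ∫ s in Set.Icc t₁ t₂, ∫ x : Literature.MathematicalPhysics.KineticTheory.T3, (eb ((Φ N).flow s z) x + pb ((Φ N).flow s z) x) / ρb ((Φ N).flow s z) x * mg ((Φ N).flow s z) x; let Dmo := fun (k : Fin 3) (z : Literature.Analysis.FluidPDE.Config (N + 1) (Fin 3) Literature.MathematicalPhysics.KineticTheory.T3) => Literature.MathematicalPhysics.KineticTheory.empiricalMomentumField ((Φ N).flow t₂ z) ζ k - Literature.MathematicalPhysics.KineticTheory.empiricalMomentumField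 ((Φ N).flow t₁ z) ζ k - ∫ s in Set.Icc t₁ t₂, ∫ x : Literature.MathematicalPhysics.KineticTheory.T3, (mg ((Φ N).flow s z) x * mb ((Φ N).flow s z) x k / ρb ((Φ N).flow s z) x + pb ((Φ N).flow s z) x * Literature.Analysis.FunctionSpaces.Torus.partialDeriv k ζ x); (MeasureTheory.Integrable Den P ∧ |∫ z, Den z ∂P| ≤ δ) ∧ ∀ k : Fin 3, MeasureTheory.Integrable (Dmo k) P ∧ |∫ z, Dmo k z ∂P| ≤ δ)

/-- item stmt-AtomisticToContinuum-7374 · crux · rank 2 · closed · moot by None · by planner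
why it might fail: flushing is diffusive and influence percolates inside a cell, so forgetting must come from the exterior's conditional randomness; a Liouville-preserving demon surgery reading the exterior microstate, slow/fast velocity tails (Yarmola2014) or memory decaying slower than (N+1)^(-1/12) break it.
sources: GoldsteinKipnisIaniro1985, KhaninYarmola2013, Yarmola2014, ChernovDolgopyat2009, OllaVaradhanYau1993
[crux] LAW-LEVEL FORGETTING OF CONSERVATIVE CELLWISE SURGERY (card gas-is-its-own-heat-bath item
(ii) "Doeblin inside", restated at law level on the torus; card borrowed-noise-inflow-cells crux 1).
Along the true evolution from local Gibbs data (σ < σ₀, horizon t < T), partition 𝕋³ into the cubic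
grid of mesh 1/M, M = ⌊(N+1)^(1/4)⌋. For every measurable Ψ on N-particle phase space that preserves
the Liouville measure and the hard-core constraint, keeps every particle inside its grid cell and
conserves the momentum and the kinetic energy of every cell, applying Ψ to the configuration at any
time s ≤ t changes the expectation of every normalised bounded continuous one-particle cell
observable (ball of radius 1/M, arbitrary centre x) at time s + τ_N, τ_N = (N+1)^(-1/12), by at most
δ·τ_N, uniformly in s ≤ t, x and Ψ, for N ≥ N₀(δ, g, t). (The admissible Ψ include Haar rotations of
cell velocities in the centre-of-mass frame and velocity reversal in that frame; the bound o(τ_N) is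
what lets window increments be read as fluxes.) [difficulty: open-problem] -/
@[route_item "route-AtomisticToContinuum-HeatBathCells"]
def CellRefresh : Prop :=
  ∀ (a₀ θ₀ : Literature.MathematicalPhysics.KineticTheory.T3 → ℝ) (u₀ : Literature.MathematicalPhysics.KineticTheory.T3 → Literature.MathematicalPhysics.KineticTheory.V3), Continuous a₀ → Continuous θ₀ → Continuous u₀ → (∀ x, 0 < a₀ x) → (∀ x, 0 < θ₀ x) → ∃ σ₀ : ℝ, 0 < σ₀ ∧ ∀ σ : ℝ, 0 < σ → σ < σ₀ → ∀ (T : ℝ) (ρ θ : ℝ → Literature.MathematicalPhysics.KineticTheory.T3 → ℝ) (u : ℝ → Literature.MathematicalPhysics.KineticTheory.T3 → Literature.MathematicalPhysics.KineticTheory.V3), Literature.MathematicalPhysics.KineticTheory.IsHardSphereEulerSolution σ T ρ u θ → ∀ Φ : (N : ℕ) → Literature.Analysis.FluidPDE.HardSphereFlow (Literature.Analysis.FluidPDE.Torus.geometry (Fin 3)) (Literature.MathematicalPhysics.KineticTheory.hsDiameter σ N) (N + 1), Literature.MathematicalPhysics.KineticTheory.TendstoHydroFieldsAt (fun N => Literature.MathematicalPhysics.KineticTheory.localGibbsLaw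 σ a₀ u₀ θ₀ N (Φ N)) Φ ρ u θ 0 → ∀ t ∈ Set.Ico 0 T, ∀ g : Literature.MathematicalPhysics.KineticTheory.V3 × Literature.MathematicalPhysics.KineticTheory.V3 → ℝ, Continuous g → (∀ p, |g p| ≤ 1) → (∀ p, 1 ≤ ‖p.1‖ → g p = 0) → ∀ δ : ℝ, 0 < δ → ∃ N₀ : ℕ, ∀ N : ℕ, N₀ ≤ N → ∀ s ∈ Set.Icc 0 t, ∀ (x : Literature.MathematicalPhysics.KineticTheory.T3) (Ψ : Literature.Analysis.FluidPDE.Config (N + 1) (Fin 3) Literature.MathematicalPhysics.KineticTheory.T3 → Literature.Analysis.FluidPDE.Config (N + 1) (Fin 3) Literature.MathematicalPhysics.KineticTheory.T3), (let M : ℕ := ⌊((N + 1 : ℕ) : ℝ) ^ (1 / 4 : ℝ)⌋₊; let hN : ℝ := (M : ℝ)⁻¹; let τN : ℝ := ((N + 1 : ℕ) : ℝ) ^ (-(1 / 12 : ℝ)); let P := Literature.MathematicalPhysics.KineticTheory.localGibbsLaw σ a₀ u₀ θ₀ N (Φ N); let cell := fun (y : Literature.MathematicalPhysics.KineticTheory.T3)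 (j : Fin 3) => ⌊(M : ℝ) * Literature.Analysis.FunctionSpaces.Torus.repr y j⌋; let A := fun (w : Literature.Analysis.FluidPDE.Config (N + 1) (Fin 3) Literature.MathematicalPhysics.KineticTheory.T3) => (hN ^ 3)⁻¹ * ∫ y, g (hN⁻¹ • Literature.Analysis.FluidPDE.Torus.reprSym (y.1 - x), y.2) ∂(Literature.Analysis.FluidPDE.empiricalMeasure w); MeasureTheory.MeasurePreserving Ψ (Literature.Analysis.FluidPDE.liouville (Literature.Analysis.FluidPDE.Torus.geometry (Fin 3)) (N + 1) (Literature.MathematicalPhysics.KineticTheory.hsDiameter σ N)) (Literature.Analysis.FluidPDE.liouville (Literature.Analysis.FluidPDE.Torus.geometry (Fin 3)) (N + 1) (Literature.MathematicalPhysics.KineticTheory.hsDiameter σ N)) → (∀ z ∈ Literature.Analysis.FluidPDE.hardSphereDomain (Literature.Analysis.FluidPDE.Torus.geometry (Fin 3)) (N + 1) (Literature.MathematicalPhysics.KineticTheory.hsDiameter σ N), Ψ z ∈ Literature.Analysis.FluidPDE.hardSphereDomain (Literature.Analysis.FluidPDE.Torus.geometry (Fin 3)) (N + 1) (Literature.MathematicalPhysics.KineticTheory.hsDiameter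 σ N)) → (∀ z i, cell (Ψ z i).1 = cell (z i).1) → (∀ z (c : Fin 3 → ℤ), (∑ i ∈ Finset.univ.filter (fun i => cell (z i).1 = c), (Ψ z i).2) = ∑ i ∈ Finset.univ.filter (fun i => cell (z i).1 = c), (z i).2 ∧ (∑ i ∈ Finset.univ.filter (fun i => cell (z i).1 = c), ‖(Ψ z i).2‖ ^ 2) = ∑ i ∈ Finset.univ.filter (fun i => cell (z i).1 = c), ‖(z i).2‖ ^ 2) → |(∫ z, A ((Φ N).flow (s + τN) z) ∂P) - ∫ z, A ((Φ N).flow τN (Ψ ((Φ N).flow s z))) ∂P| ≤ δ * τN)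

-- earlier RefreshToClosure (stmt-AtomisticToContinuum-7375, replaced 2026-08-15T12:19:01Z -> stmt-AtomisticToContinuum-7851): retired by None — CellRefresh → CubicMomentUI → HsEosLowDensity → MesoFluxClosure
/-- item stmt-AtomisticToContinuum-7851 · crux · rank 3 · closed · moot by None · by planner
why it might fail: forgetting alone identifies nothing (the free gas forgets perfectly yet violates closure, BoltzmannHypothesisBarrierNarrow (5)); needs measure-preserving position scramblers respecting the hard core at cell faces, and the window entropy bound N^(11/12)=o(N) leaves no room for lost logarithms.
sources: DobrushinShlosman1985, MaesShlosman1991, LebowitzMaesSpeer1990, OllaVaradhanYau1993, Ruelle1969, LebowitzPenrose1964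
[crux] FORGETTING ⇒ CLOSURE (card item (iii), the Dobrushin–Shlosman identification, at finite N):
CellRefresh → CubicMomentUI → HsEosLowDensity → MesoFluxClosure. Intended proof: cut [t₁,t₂] into
windows of length τ_N; by exact conservation the window increment of ⟨η, ζ⟩ IS the time-integrated
flux (collisional transfer included); by CellRefresh with the randomised admissible surgery
"resample every cell microcanonically at the window start" (average of admissible Ψ's) the mean
increment equals, up to o(τ_N), the one computed from the cellwise-Gibbsianised law; that law
produces only o(N) relative entropy over the window (face crossings × quadratic parameter jumps ≍
h_N⁻⁴·τ_N = N^(11/12) = o(N)), so its mean flux is the Gibbs expectation = Euler flux at the cell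
parameters by the virial theorem and low-density equivalence of ensembles (Knudsen layers at cell
faces have volume fraction λ/h_N → 0); CubicMomentUI truncates the unbounded flux observables.
[deps: CellRefresh, CubicMomentUI, HsEosLowDensity] [difficulty: XL] -/
@[route_item "route-AtomisticToContinuum-HeatBathCells"]
def RefreshToClosure : Prop :=
  CellRefresh → (∀ (a₀ θ₀ : Literature.MathematicalPhysics.KineticTheory.T3 → ℝ) (u₀ : Literature.MathematicalPhysics.KineticTheory.T3 → Literature.MathematicalPhysics.KineticTheory.V3), Continuous a₀ → Continuous θ₀ → Continuous u₀ → (∀ x, 0 < a₀ x) → (∀ x, 0 < θ₀ x) → ∃ σ₀ : ℝ, 0 < σ₀ ∧ ∀ σ : ℝ, 0 < σ → σ < σ₀ → ∀ (T : ℝ) (ρ θ : ℝ → Literature.MathematicalPhysics.KineticTheory.T3 → ℝ) (u : ℝ → Literature.MathematicalPhysics.KineticTheory.T3 → Literature.MathematicalPhysics.KineticTheory.V3), Literature.MathematicalPhysics.KineticTheory.IsHardSphereEulerSolution σ T ρ u θ → ∀ Φ : (N : ℕ) → Literature.Analysis.FluidPDE.HardSphereFlow (Literature.Analysis.FluidPDE.Torus.geometry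 (Fin 3)) (Literature.MathematicalPhysics.KineticTheory.hsDiameter σ N) (N + 1), Literature.MathematicalPhysics.KineticTheory.TendstoHydroFieldsAt (fun N => Literature.MathematicalPhysics.KineticTheory.localGibbsLaw σ a₀ u₀ θ₀ N (Φ N)) Φ ρ u θ 0 → ∀ t ∈ Set.Ico 0 T, ∀ δ : ℝ, 0 < δ → ∃ K₀ : ℝ, ∃ N₀ : ℕ, ∀ N : ℕ, N₀ ≤ N → ∀ s ∈ Set.Icc 0 t, ∫⁻ z, ENNReal.ofReal (∫ y, (if K₀ < ‖y.2‖ then ‖y.2‖ ^ 3 else 0) ∂(Literature.Analysis.FluidPDE.empiricalMeasure ((Φ N).flow s z))) ∂(Literature.MathematicalPhysics.KineticTheory.localGibbsLaw σ a₀ u₀ θ₀ N (Φ N)) ≤ ENNReal.ofReal δ) → (∃ η₀ : ℝ, 0 < η₀ ∧ ∃ F : ℝ → ℝ, AnalyticOnNhd ℝ F (Set.Ioo (-η₀) η₀) ∧ Set.EqOn Literature.MathematicalPhysics.KineticTheory.hsExcessFreeEnergy F (Set.Ico 0 η₀) ∧ F 0 = 0 ∧ deriv F 0 = 2 * Real.pi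 / 3 ∧ ∀ η ∈ Set.Ico 0 η₀, Filter.Tendsto (fun N : ℕ => -(N : ℝ)⁻¹ * Real.log (Literature.MathematicalPhysics.KineticTheory.hsFreeVolume η N)) Filter.atTop (nhds (F η))) → MesoFluxClosure

-- TODO item stmt-AtomisticToContinuum-7376 · crux · rank 4 · closed · moot by None · by planner — BLOCKED: missing decl(s) CubicMomentUI, HsEosLowDensity, LocalGibbsConcentration, RelEntropyVanishing; restate via `ledger route edit` once they land:
--   def ClosureToEntropy : Prop := MesoFluxClosure → (∀ (a₀ θ₀ : Literature.MathematicalPhysics.KineticTheory.T3 → ℝ) (u₀ : Literature.MathematicalPhysics.KineticTheory.T3 → Literature.MathematicalPhysics.KineticTheory.V3), Continuous a₀ → Continuous θ₀ → Continuous u₀ → (∀ x, 0 < a₀ x) → (∀ x, 0 < θ₀ x) → ∃ σ₀ : ℝ, 0 < σ₀ ∧ ∀ σ : ℝ,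

/-- item stmt-AtomisticToContinuum-7377 · crux · rank 5 · closed · moot by None · by planner
why it might fail: only total kinetic energy is conserved; a vanishing fraction of particles could take a non-vanishing energy share over macroscopic times (cascade to fast particles) and no a-priori estimate excludes this at fixed density (HighMomentumCutoffBarrier: OVY modified the kinetic energy to avoid it).
sources: OllaVaradhanYau1993, Spohn1991, KipnisLandim1999
[crux] UNIFORM INTEGRABILITY OF THE CUBIC VELOCITY MOMENT ALONG THE EVOLUTION (the honest form of
LargeVelocityControl 0781 — exponential cubic moments are infinite already for Maxwellians): for σ <
σ₀, local Gibbs data and t < T, sup over s ≤ t and N ≥ N₀ of E[(N+1)⁻¹ Σ_i |v_i(s)|³ 1(|v_i(s)| >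
K)] ≤ δ for K = K(δ, t). Needed to truncate the energy flux (E+p)m/ρ ≲ block average of |v|³ in
cruxes 3 and 4. [difficulty: L] -/
@[route_item "route-AtomisticToContinuum-HeatBathCells"]
def CubicMomentUI : Prop :=
  ∀ (a₀ θ₀ : Literature.MathematicalPhysics.KineticTheory.T3 → ℝ) (u₀ : Literature.MathematicalPhysics.KineticTheory.T3 → Literature.MathematicalPhysics.KineticTheory.V3), Continuous a₀ → Continuous θ₀ → Continuous u₀ → (∀ x, 0 < a₀ x) → (∀ x, 0 < θ₀ x) → ∃ σ₀ : ℝ, 0 < σ₀ ∧ ∀ σ : ℝ, 0 < σ → σ < σ₀ → ∀ (T : ℝ) (ρ θ : ℝ → Literature.MathematicalPhysics.KineticTheory.T3 → ℝ) (u : ℝ → Literature.MathematicalPhysics.KineticTheory.T3 → Literature.MathematicalPhysics.KineticTheory.V3), Literature.MathematicalPhysics.KineticTheory.IsHardSphereEulerSolution σ T ρ u θ → ∀ Φ : (N : ℕ) → Literature.Analysis.FluidPDE.HardSphereFlow (Literature.Analysis.FluidPDE.Torus.geometry (Fin 3)) (Literature.MathematicalPhysics.KineticTheory.hsDiameter σ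 N) (N + 1), Literature.MathematicalPhysics.KineticTheory.TendstoHydroFieldsAt (fun N => Literature.MathematicalPhysics.KineticTheory.localGibbsLaw σ a₀ u₀ θ₀ N (Φ N)) Φ ρ u θ 0 → ∀ t ∈ Set.Ico 0 T, ∀ δ : ℝ, 0 < δ → ∃ K₀ : ℝ, ∃ N₀ : ℕ, ∀ N : ℕ, N₀ ≤ N → ∀ s ∈ Set.Icc 0 t, ∫⁻ z, ENNReal.ofReal (∫ y, (if K₀ < ‖y.2‖ then ‖y.2‖ ^ 3 else 0) ∂(Literature.Analysis.FluidPDE.empiricalMeasure ((Φ N).flow s z))) ∂(Literature.MathematicalPhysics.KineticTheory.localGibbsLaw σ a₀ u₀ θ₀ N (Φ N)) ≤ ENNReal.ofReal δ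

/-- item stmt-AtomisticToContinuum-0766 · support · rank 9 · open · by planner
sources: Yau1991, OllaVaradhanYau1993
[target] X_RE: for all continuous profiles ∃ σ₀ ∀ σ<σ₀ ∀ classical hs-Euler solutions on [0,T) ∀
flows: the initial local Gibbs laws are probability measures and, if their fields converge at t=0,
then ∀ t<T ∃ activity profile a_t such that the reference local Gibbs law (a_t, u_t, θ_t) is a
probability measure whose empirical density/momentum/energy fields concentrate exponentially (≤ C
e^{-(N+1)/C}) around (ρ,ρu,E)(t), and klDiv(lawAt Φ_N (localGibbs a₀u₀θ₀) t ‖ localGibbs a_t u_t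
θ_t)/(N+1) → 0. Yau1991; OllaVaradhanYau1993 Thm 1.1 (with noise). -/
@[route_item "route-AtomisticToContinuum-HeatBathCells"]
def RelEntropyVanishing : Prop :=
  ∀ (a₀ θ₀ : Literature.MathematicalPhysics.KineticTheory.T3 → ℝ) (u₀ : Literature.MathematicalPhysics.KineticTheory.T3 → Literature.MathematicalPhysics.KineticTheory.V3), Continuous a₀ → Continuous θ₀ → Continuous u₀ → (∀ x, 0 < a₀ x) → (∀ x, 0 < θ₀ x) → ∃ σ₀ : ℝ, 0 < σ₀ ∧ ∀ σ : ℝ, 0 < σ → σ < σ₀ → ∀ (T : ℝ) (ρ θ : ℝ → Literature.MathematicalPhysics.KineticTheory.T3 → ℝ) (u : ℝ → Literature.MathematicalPhysics.KineticTheory.T3 → Literature.MathematicalPhysics.KineticTheory.V3), Literature.MathematicalPhysics.KineticTheory.IsHardSphereEulerSolution σ T ρ u θ → ∀ Φ : (N : ℕ) → Literature.Analysis.FluidPDE.HardSphereFlow (Literature.Analysis.FluidPDE.Torus.geometry (Fin 3)) (Literature.MathematicalPhysics.KineticTheory.hsDiameter σ N) (N + 1), (∀ N, MeasureTheory.IsProbabilityMeasure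 (Literature.MathematicalPhysics.KineticTheory.localGibbsLaw σ a₀ u₀ θ₀ N (Φ N))) ∧ (Literature.MathematicalPhysics.KineticTheory.TendstoHydroFieldsAt (fun N => Literature.MathematicalPhysics.KineticTheory.localGibbsLaw σ a₀ u₀ θ₀ N (Φ N)) Φ ρ u θ 0 → ∀ t ∈ Set.Ico 0 T, ∃ a : Literature.MathematicalPhysics.KineticTheory.T3 → ℝ, (∀ N, MeasureTheory.IsProbabilityMeasure (Literature.MathematicalPhysics.KineticTheory.localGibbsLaw σ a (u t) (θ t) N (Φ N))) ∧ (∀ χ : Literature.MathematicalPhysics.KineticTheory.T3 → ℝ, Continuous χ → ∀ δ : ℝ, 0 < δ → ∃ C : ℝ, 0 < C ∧ ∀ N : ℕ, Literature.MathematicalPhysics.KineticTheory.localGibbsLaw σ a (u t) (θ t) N (Φ N) {z | δ < |Literature.MathematicalPhysics.KineticTheory.empiricalDensityField z χ - ∫ x, χ x * ρ t x|} ≤ ENNReal.ofReal (C * Real.exp (-(C⁻¹ * (N + 1)))) ∧ Literature.MathematicalPhysics.KineticTheory.localGibbsLaw σ a (u t) (θ t) N (Φ N) {z | δ < ‖Literature.MathematicalPhysics.KineticTheory.empiricalMomentumField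 z χ - ∫ x, (χ x * ρ t x) • u t x‖} ≤ ENNReal.ofReal (C * Real.exp (-(C⁻¹ * (N + 1)))) ∧ Literature.MathematicalPhysics.KineticTheory.localGibbsLaw σ a (u t) (θ t) N (Φ N) {z | δ < |Literature.MathematicalPhysics.KineticTheory.empiricalEnergyField z χ - ∫ x, χ x * Literature.MathematicalPhysics.KineticTheory.totalEnergyDensity (ρ t x) (u t x) (θ t x)|} ≤ ENNReal.ofReal (C * Real.exp (-(C⁻¹ * (N + 1))))) ∧ Filter.Tendsto (fun N : ℕ => InformationTheory.klDiv ((Φ N).lawAt (Literature.MathematicalPhysics.KineticTheory.localGibbsLaw σ a₀ u₀ θ₀ N (Φ N)) t) (Literature.MathematicalPhysics.KineticTheory.localGibbsLaw σ a (u t) (θ t) N (Φ N)) / ((N : ENNReal) + 1)) Filter.atTop (nhds 0))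

/-- item stmt-AtomisticToContinuum-0767 · support · rank 9 · closed · moot by None · by planner
sources: Ruelle1969, LebowitzPenrose1964
[support] Exponential law of large numbers for canonical local Gibbs states of N+1 hard spheres of
diameter σ(N+1)^{-1/3} on 𝕋³: for continuous a, θ₀ > 0, u₀, ∃ σ₀ ∀ σ<σ₀ ∃ continuous ρ₀ > 0
(equilibrium density profile at activity a) with the laws probability measures for all N and
P(|field − limit| > δ) ≤ C e^{-(N+1)/C} for the three fields, C = C(χ, δ) uniform in N and in the
flow. Low-density cluster expansion (Ruelle1969 Ch. 4, LebowitzPenrose1964) + Gaussian velocities.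
Strengthens Literature fact localGibbs_lln. -/
@[route_item "route-AtomisticToContinuum-HeatBathCells"]
def LocalGibbsConcentration : Prop :=
  ∀ (a θ₀ : Literature.MathematicalPhysics.KineticTheory.T3 → ℝ) (u₀ : Literature.MathematicalPhysics.KineticTheory.T3 → Literature.MathematicalPhysics.KineticTheory.V3), Continuous a → Continuous θ₀ → Continuous u₀ → (∀ x, 0 < a x) → (∀ x, 0 < θ₀ x) → ∃ σ₀ : ℝ, 0 < σ₀ ∧ ∀ σ : ℝ, 0 < σ → σ < σ₀ → ∃ ρ₀ : Literature.MathematicalPhysics.KineticTheory.T3 → ℝ, Continuous ρ₀ ∧ (∀ x, 0 < ρ₀ x) ∧ (∀ (N : ℕ) (Φ : Literature.Analysis.FluidPDE.HardSphereFlow (Literature.Analysis.FluidPDE.Torus.geometry (Fin 3)) (Literature.MathematicalPhysics.KineticTheory.hsDiameter σ N) (N + 1)), MeasureTheory.IsProbabilityMeasure (Literature.MathematicalPhysics.KineticTheory.localGibbsLaw σ a u₀ θ₀ N Φ)) ∧ ∀ χ : Literature.MathematicalPhysics.KineticTheory.T3 → ℝ, Continuous χ → ∀ δ : ℝ, 0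 < δ → ∃ C : ℝ, 0 < C ∧ ∀ (N : ℕ) (Φ : Literature.Analysis.FluidPDE.HardSphereFlow (Literature.Analysis.FluidPDE.Torus.geometry (Fin 3)) (Literature.MathematicalPhysics.KineticTheory.hsDiameter σ N) (N + 1)), Literature.MathematicalPhysics.KineticTheory.localGibbsLaw σ a u₀ θ₀ N Φ {z | δ < |Literature.MathematicalPhysics.KineticTheory.empiricalDensityField z χ - ∫ x, χ x * ρ₀ x|} ≤ ENNReal.ofReal (C * Real.exp (-(C⁻¹ * (N + 1)))) ∧ Literature.MathematicalPhysics.KineticTheory.localGibbsLaw σ a u₀ θ₀ N Φ {z | δ < ‖Literature.MathematicalPhysics.KineticTheory.empiricalMomentumField z χ - ∫ x, (χ x * ρ₀ x) • u₀ x‖} ≤ ENNReal.ofReal (C * Real.exp (-(C⁻¹ * (N + 1)))) ∧ Literature.MathematicalPhysics.KineticTheory.localGibbsLaw σ a u₀ θ₀ N Φ {z | δ < |Literature.MathematicalPhysics.KineticTheory.empiricalEnergyField z χ - ∫ x, χ x * Literature.MathematicalPhysics.KineticTheory.totalEnergyDensity (ρ₀ x) (u₀ x) (θ₀ x)|} ≤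 ENNReal.ofReal (C * Real.exp (-(C⁻¹ * (N + 1))))

/-- item stmt-AtomisticToContinuum-0768 · support · rank 9 · open · by planner
sources: Ruelle1969, LebowitzPenrose1964
[support] Hard-sphere equation of state at low density: ∃ η₀ > 0 and F real-analytic on (−η₀, η₀)
with hsExcessFreeEnergy = F on [0, η₀), F(0) = 0, F'(0) = 2π/3 (second virial coefficient of
unit-diameter spheres), and the canonical thermodynamic limit −N⁻¹ log hsFreeVolume η N → F(η)
exists (not just limsup) for η ∈ [0, η₀). Ruelle1969 §3.4 (existence), LebowitzPenrose1964
(convergence of the virial expansion ⇒ analyticity). Makes hsCompressibility/hsPressure smooth and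
Z(η) = 1 + (2π/3)η + O(η²); needed by every route (hyperbolicity of the Euler system, virial
theorem). -/
@[route_item "route-AtomisticToContinuum-HeatBathCells"]
def HsEosLowDensity : Prop :=
  ∃ η₀ : ℝ, 0 < η₀ ∧ ∃ F : ℝ → ℝ, AnalyticOnNhd ℝ F (Set.Ioo (-η₀) η₀) ∧ Set.EqOn Literature.MathematicalPhysics.KineticTheory.hsExcessFreeEnergy F (Set.Ico 0 η₀) ∧ F 0 = 0 ∧ deriv F 0 = 2 * Real.pi / 3 ∧ ∀ η ∈ Set.Ico 0 η₀, Filter.Tendsto (fun N : ℕ => -(N : ℝ)⁻¹ * Real.log (Literature.MathematicalPhysics.KineticTheory.hsFreeVolume η N)) Filter.atTop (nhds (F η))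

/-- item stmt-AtomisticToContinuum-0769 · support · rank 9 · open · by planner
sources: Yau1991, KipnisLandim1999
[assembly] X_RE → HydrodynamicLimit: entropy inequality μ(A) ≤ (log 2 + H(μ|λ))/log(1 + 1/λ(A))
(from Donsker–Varadhan / Mathlib klDiv API) with λ(A) ≤ C e^{-(N+1)/C} and H = o(N) gives μ(A) → 0;
μ = lawAt (Φ N) P t = P.map (flow t) turns μ{z | δ < |field z − ·|} into P{z | δ < |field (flow t z)
− ·|} (measurable_flow); the reference concentration is stated for z itself and TendstoHydroFieldsAt
at time 0 of the reference law is not needed. Zero-mass case impossible by the IsProbabilityMeasure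
clauses; take σ₀ from X_RE. -/
@[route_item "route-AtomisticToContinuum-HeatBathCells"]
def EntropyToHydro : Prop :=
  RelEntropyVanishing → Literature.MathematicalPhysics.KineticTheory.HydrodynamicLimit

-- TODO item stmt-AtomisticToContinuum-7378 · assembly · rank 1 · closed · moot by None · by planner — BLOCKED: missing decl(s) ClosureToEntropy, RefreshToClosure; restate via `ledger route edit` once they land:
--   def Assembly : Prop := CellRefresh → RefreshToClosure → CubicMomentUI → LocalGibbsConcentration → HsEosLowDensity → ClosureToEntropy → EntropyToHydro → Literature.MathematicalPhysics.KineticTheory.HydrodynamicLimit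

end Summit.AtomisticToContinuum.HydrodynamicLimit.Theses.HeatBathCells
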